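import Summits.CriticalPhenomena.PercolationContinuityZ3.Theorems.PercNearOneGluingNoHeavyLowerTailSahiE3UnionTensorMeasure
import Summits.CriticalPhenomena.PercolationContinuityZ3.Theorems.PercNearOneGluingNoHeavyLowerTailSahiCubeThreeAllOrders
import Mathlib.Algebra.Order.GroupWithZero.Basic
import Literature.Combinatorics.Sahi2008.FKG
import HarnessLib

/-!
# `NoHeavyLowerTail` (crux stmt-CriticalPhenomena-4575), Sahi programme P4: `C₃` passes to RECTANGLE UNIONS and RECTANGLE PRODUCTS on a
# product of two positively associated spaces — the lattice-level OR and AND steps; blocks `2^X × 2^Y`, `|X|,|Y| ≤ 3`, arbitrary FKG weights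

Support file (cell `prim-l12`, seat P4, generation 32; `--supports stmt-CriticalPhenomena-4575`).  No definitions, no named facts, no sorries;
standard axioms.  Companions: `…SahiE3UnionTensor` (algebra), `…SahiE3UnionTensorMeasure` (`sahiE_three_por_nonneg`), and the computational leaf
`…SahiE3UnionTensorCube` (cubes with blocks of `≤ 4` coins, via the kernel certificate `C₃` on four coins).

* `sahiE_three_por_nonneg_of_sahiPositive_two` — OR STEP, LATTICE LEVEL: `γ`, `β` finite preorders with nonnegative probability weights `μ`, `ν` that
  are Sahi-positive of order `2` (positive association / Harris–FKG); `a_i : γ → [0,1]`, `b_i : β → [0,1]` monotone with `E₃(a) ≥ 0` under `μ` and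
  `E₃(b) ≥ 0` under `ν` (e.g. both weights Sahi-positive of order `3`: Sahi's `C₃` [Sahi2008, Conj. 5 at n = 3] = Kahn's Conjecture 5 [Kahn2022,
  Conj. 5] on that space).  Then the probabilistic ORs `u_i(x,y) = a_i(x) + b_i(y) − a_i(x)b_i(y)` (indicators of `A_i × β ∪ γ × B_i`) have
  `E₃(u_0,u_1,u_2) ≥ 0` under `μ ⊗ ν`.  Only `E₃` of the two given triples enters beyond Harris: an INDUCTIVE STEP.
* `sahiE_three_por_nonneg_set_of_card_le_three` — NON-PRODUCT BLOCKS: `2^X × 2^Y`, `|X|, |Y| ≤ 3`, any two FKG block weights (tree: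
  `SahiCubeAllOrders.sahiPositive_set_of_card_le_three`, extending [Sahi2008, Prop. 15]), monotone `[0,1]`-valued block functions.
* THE AND STEP AT ROW LEVEL (`e3Tensor_nonneg_of_holdMoments`, `sahiE_three_pand_nonneg`, `sahiE_three_pand_nonneg_of_sahiPositive_two`): the
  order-3 product formula `E₃(a⊗b) = E₃(a)·E[b_0b_1b_2] + Σ κ_{ij}E[a_k]·Cov(b_ib_j,b_k) + ΠE[a_i]·E₃(b)` (cf. `SahiTotalCumulance.sahiE_prod_tensor_eq`)
  needs only rows, so products with one more positively associated block also preserve `E₃ ≥ 0` given only `E₃ ≥ 0` of the two triples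
  (the tree's `sahiE_prod_tensor_nonneg'` asks for Sahi positivity of orders `≤ 3` of both weights).
* `isFKGMeasure_prod` — product weights of FKG weights are FKG on the product lattice, so the lattice-level steps ITERATE over any number of
  FKG blocks each satisfying `C₃`.
HONEST FRAMING: closure/inheritance results; nothing is asserted about `C₃` in general. [this work]
-/

noncomputable section

namespace Summit.CriticalPhenomena.PercolationContinuityZ3.Theorems.SahiE3UnionTensor

open Finset Function Literature.Combinatorics.Sahi2008

/-! ### Lattice level: rows from Sahi positivity of orders 2 and 3 -/

section Lattice

variable {γ β : Type*} [Fintype γ] [Fintype β] [Preorder γ] [Preorder β]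

omit [Fintype β] [Preorder β] in
/-- Harris' inequality (order-`2` Sahi positivity) for a pair of nonnegative monotone functions, in product form. [folklore] -/
theorem ex_mul_le_of_sahiPositive_two (μ : γ → ℝ) (h2 : SahiPositive μ 2) (f g : γ → ℝ) (hf0 : ∀ x, 0 ≤ f x) (hg0 : ∀ x, 0 ≤ g x)
    (hf : Monotone f) (hg : Monotone g) : ex μ f * ex μ g ≤ ex μ (f * g) := by
  have h := h2 ![f, g] (fun i x => by fin_cases i <;> simp [hf0 x, hg0 x]) (fun i => by fin_cases i <;> simpa)
  rw [sahiE_two] at h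
  linarith

/-- **Lattice level: `E₃` of probabilistic ORs of two independent monotone `[0,1]`-triples is nonnegative** when both weights are
positively associated (Sahi-positive of order `2`, i.e. Harris–FKG) and EACH OF THE TWO TRIPLES has `E₃ ≥ 0` under its own weight (e.g. both
weights Sahi-positive of order `3`).  Only `E₃` of the two given triples enters — so the theorem is an INDUCTIVE STEP: OR-ing a further independent
positively associated block whose triple has `E₃ ≥ 0` preserves `E₃ ≥ 0`. [this work] -/
theorem sahiE_three_por_nonneg_of_sahiPositive_two (μ : γ → ℝ) (ν : β → ℝ)
    (hμ0 : ∀ t, 0 ≤ μ t) (hμ1 : ∑ t, μ t = 1) (hν0 : ∀ t, 0 ≤ ν t) (hν1 : ∑ t, ν t = 1)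
    (hμ2 : SahiPositive μ 2) (hν2 : SahiPositive ν 2)
    (a : Fin 3 → γ → ℝ) (b : Fin 3 → β → ℝ) (ha0 : ∀ i t, 0 ≤ a i t) (ha1 : ∀ i t, a i t ≤ 1) (ham : ∀ i, Monotone (a i))
    (hb0 : ∀ i t, 0 ≤ b i t) (hb1 : ∀ i t, b i t ≤ 1) (hbm : ∀ i, Monotone (b i))
    (hea : 0 ≤ sahiE μ 3 a) (heb : 0 ≤ sahiE ν 3 b) :
    0 ≤ sahiE (fun p : γ × β => μ p.1 * ν p.2) 3 (fun (i : Fin 3) (p : γ × β) => a i p.1 + b i p.2 - a i p.1 * b i p.2) := by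
  -- products of two members are nonnegative monotone
  have haa : ∀ i j, Monotone (a i * a j) := fun i j => (ham i).mul (ham j) (ha0 i) (ha0 j)
  have hbb : ∀ i j, Monotone (b i * b j) := fun i j => (hbm i).mul (hbm j) (hb0 i) (hb0 j)
  have haa0 : ∀ i j t, 0 ≤ (a i * a j) t := fun i j t => mul_nonneg (ha0 i t) (ha0 j t)
  have hbb0 : ∀ i j t, 0 ≤ (b i * b j) t := fun i j t => mul_nonneg (hb0 i t) (hb0 j t)
  have ra : ∀ i j k, ex μ (a i * a j) * ex μ (a k) ≤ ex μ (a i * a j * a k) := fun i j k =>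
    ex_mul_le_of_sahiPositive_two μ hμ2 _ _ (haa0 i j) (ha0 k) (haa i j) (ham k)
  have rb : ∀ i j k, ex ν (b i * b j) * ex ν (b k) ≤ ex ν (b i * b j * b k) := fun i j k =>
    ex_mul_le_of_sahiPositive_two ν hν2 _ _ (hbb0 i j) (hb0 k) (hbb i j) (hbm k)
  have e120 : ∀ (f : Fin 3 → γ → ℝ), f 1 * f 2 * f 0 = f 0 * f 1 * f 2 := fun f => by ring
  have e021 : ∀ (f : Fin 3 → γ → ℝ), f 0 * f 2 * f 1 = f 0 * f 1 * f 2 := fun f => by ring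
  have e120' : ∀ (f : Fin 3 → β → ℝ), f 1 * f 2 * f 0 = f 0 * f 1 * f 2 := fun f => by ring
  have e021' : ∀ (f : Fin 3 → β → ℝ), f 0 * f 2 * f 1 = f 0 * f 1 * f 2 := fun f => by ring
  refine sahiE_three_por_nonneg μ ν hμ0 hμ1 hν0 hν1 a b ha0 ha1 hb0 hb1
    (ex_mul_le_of_sahiPositive_two μ hμ2 _ _ (ha0 0) (ha0 1) (ham 0) (ham 1))
    (ex_mul_le_of_sahiPositive_two μ hμ2 _ _ (ha0 0) (ha0 2) (ham 0) (ham 2))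
    (ex_mul_le_of_sahiPositive_two μ hμ2 _ _ (ha0 1) (ha0 2) (ham 1) (ham 2))
    (by simpa only [e120] using ra 1 2 0) (by simpa only [e021] using ra 0 2 1) (ra 0 1 2) hea
    (ex_mul_le_of_sahiPositive_two ν hν2 _ _ (hb0 0) (hb0 1) (hbm 0) (hbm 1))
    (ex_mul_le_of_sahiPositive_two ν hν2 _ _ (hb0 0) (hb0 2) (hbm 0) (hbm 2))
    (ex_mul_le_of_sahiPositive_two ν hν2 _ _ (hb0 1) (hb0 2) (hbm 1) (hbm 2))
    (by simpa only [e120'] using rb 1 2 0) (by simpa only [e021'] using rb 0 2 1) (rb 0 1 2) heb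

end Lattice


/-! ### Blocks with internal FKG dependence: `2^X × 2^Y`, `|X|, |Y| ≤ 3`, arbitrary FKG block weights -/

section Blocks

variable {X Y : Type*} [Fintype X] [Fintype Y]

/-- **Unconditional, non-product block weights**: on `2^X × 2^Y` with `|X|, |Y| ≤ 3` and ANY two FKG probability weights `μ` on `2^X`,
`ν` on `2^Y` (Sahi's conjecture holds on `2^X`, `|X| ≤ 3`, at every order: tree `SahiCubeAllOrders.sahiPositive_set_of_card_le_three`,
extending [Sahi2008, Prop. 15]), every triple of probabilistic ORs `a_i ⊕ b_i − a_ib_i` of monotone `[0,1]`-valued block functions — e.g.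
the indicators of `A_i × 2^Y ∪ 2^X × B_i` for up-sets `A_i ⊆ 2^X`, `B_i ⊆ 2^Y` — has `E₃ ≥ 0` under `μ ⊗ ν` (two independent blocks, each
with internal positive dependence, e.g. two ferromagnetic Ising triangles). [this work] -/
theorem sahiE_three_por_nonneg_set_of_card_le_three (hX : Fintype.card X ≤ 3) (hY : Fintype.card Y ≤ 3)
    {μ : Set X → ℝ} {ν : Set Y → ℝ} (hμ : IsFKGMeasure μ) (hν : IsFKGMeasure ν)
    (a : Fin 3 → Set X → ℝ) (b : Fin 3 → Set Y → ℝ) (ha0 : ∀ i t, 0 ≤ a i t) (ha1 : ∀ i t, a i t ≤ 1) (ham : ∀ i, Monotone (a i))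
    (hb0 : ∀ i t, 0 ≤ b i t) (hb1 : ∀ i t, b i t ≤ 1) (hbm : ∀ i, Monotone (b i)) :
    0 ≤ sahiE (fun p : Set X × Set Y => μ p.1 * ν p.2) 3 (fun (i : Fin 3) (p : Set X × Set Y) => a i p.1 + b i p.2 - a i p.1 * b i p.2) :=
  sahiE_three_por_nonneg_of_sahiPositive_two μ ν hμ.nonneg hμ.sum_eq_one hν.nonneg hν.sum_eq_one
    (SahiCubeAllOrders.sahiPositive_set_of_card_le_three hX hμ 2) (SahiCubeAllOrders.sahiPositive_set_of_card_le_three hY hν 2)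
    a b ha0 ha1 ham hb0 hb1 hbm
    (SahiCubeAllOrders.sahiPositive_set_of_card_le_three hX hμ 3 a ha0 ham) (SahiCubeAllOrders.sahiPositive_set_of_card_le_three hY hν 3 b hb0 hbm)

end Blocks

/-! ### The AND step at row level (tensor slots `a_i ⊗ b_i`)

The tree's tensorisation `SahiTotalCumulance.sahiE_prod_tensor_nonneg'` asks for Sahi positivity of orders `≤ 3` of BOTH weights; at order 3 the
product formula only involves `E₃(a)`, the Harris rows `Cov(a_i,a_j)`, the masses `E[a_k]` on one side and `E[b_0b_1b_2]`, the hereditary Harris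
rows `Cov(b_ib_j, b_k)` and `E₃(b)` on the other — so, exactly as for unions, `E₃ ≥ 0` of the two given triples is all that enters beyond Harris.
This row-level form is the AND inductive step (any accumulated side with `E₃ ≥ 0`, one more positively associated block). -/

section AndStep

/-- **Order-3 product formula as a manifestly nonnegative sum** (hold moments `t_S = E Π_{i∈S} a_i`, `s_S` likewise):
`E₃(a⊗b) = E₃(a)·s_{012} + Σ_{ij|k} κ_{ij} t_k ρ'_{ij,k} + t_0t_1t_2·E₃(b)` (`κ_{ij} = t_{ij} − t_it_j`, `ρ'_{ij,k} = s_{012} − s_{ij}s_k`), hence `≥ 0`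
under the rows. [this work] -/
theorem e3Tensor_nonneg_of_holdMoments (t0 t1 t2 t01 t02 t12 t012 s0 s1 s2 s01 s02 s12 s012 : ℝ)
    (ht0 : 0 ≤ t0) (ht1 : 0 ≤ t1) (ht2 : 0 ≤ t2) (hk01 : t0 * t1 ≤ t01) (hk02 : t0 * t2 ≤ t02) (hk12 : t1 * t2 ≤ t12)
    (heA : 0 ≤ 2 * t012 + t0 * t1 * t2 - (t0 * t12 + t1 * t02 + t2 * t01))
    (hs012 : 0 ≤ s012) (hr0 : s12 * s0 ≤ s012) (hr1 : s02 * s1 ≤ s012) (hr2 : s01 * s2 ≤ s012)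
    (heB : 0 ≤ 2 * s012 + s0 * s1 * s2 - (s0 * s12 + s1 * s02 + s2 * s01)) :
    0 ≤ 2 * (t012 * s012) + (t0 * s0) * (t1 * s1) * (t2 * s2) - ((t0 * s0) * (t12 * s12) + (t1 * s1) * (t02 * s02) + (t2 * s2) * (t01 * s01)) := by
  have key : 2 * (t012 * s012) + (t0 * s0) * (t1 * s1) * (t2 * s2) - ((t0 * s0) * (t12 * s12) + (t1 * s1) * (t02 * s02) + (t2 * s2) * (t01 * s01))
      = (2 * t012 + t0 * t1 * t2 - (t0 * t12 + t1 * t02 + t2 * t01)) * s012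
        + (t12 - t1 * t2) * t0 * (s012 - s12 * s0) + (t02 - t0 * t2) * t1 * (s012 - s02 * s1) + (t01 - t0 * t1) * t2 * (s012 - s01 * s2)
        + (t0 * t1 * t2) * (2 * s012 + s0 * s1 * s2 - (s0 * s12 + s1 * s02 + s2 * s01)) := by
    ring
  rw [key]
  have p1 : 0 ≤ (2 * t012 + t0 * t1 * t2 - (t0 * t12 + t1 * t02 + t2 * t01)) * s012 := mul_nonneg heA hs012
  have p2 : 0 ≤ (t12 - t1 * t2) * t0 * (s012 - s12 * s0) := mul_nonneg (mul_nonneg (by linarith only [hk12]) ht0) (by linarith only [hr0])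
  have p3 : 0 ≤ (t02 - t0 * t2) * t1 * (s012 - s02 * s1) := mul_nonneg (mul_nonneg (by linarith only [hk02]) ht1) (by linarith only [hr1])
  have p4 : 0 ≤ (t01 - t0 * t1) * t2 * (s012 - s01 * s2) := mul_nonneg (mul_nonneg (by linarith only [hk01]) ht2) (by linarith only [hr2])
  have p5 : 0 ≤ (t0 * t1 * t2) * (2 * s012 + s0 * s1 * s2 - (s0 * s12 + s1 * s02 + s2 * s01)) :=
    mul_nonneg (mul_nonneg (mul_nonneg ht0 ht1) ht2) heB
  exact add_nonneg (add_nonneg (add_nonneg (add_nonneg p1 p2) p3) p4) p5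

/-- **`E₃` of TENSOR slots `a_i ⊗ b_i` at row level** (measure level): nonnegative `a_i : γ → ℝ`, `b_i : β → ℝ` under probability weights with the
Harris rows `E[a_i]E[a_j] ≤ E[a_ia_j]` and `E₃(a) ≥ 0` on one side, the hereditary rows `E[b_ib_j]E[b_k] ≤ E[b_0b_1b_2]` and `E₃(b) ≥ 0` on the other
⇒ `E₃^{μ⊗ν}(a_0b_0, a_1b_1, a_2b_2) ≥ 0`.  (The tree's `sahiE_prod_tensor_nonneg` with the order-3 hypotheses spelled out as rows.) [this work] -/
theorem sahiE_three_pand_nonneg {γ β : Type*} [Fintype γ] [Fintype β] (μ : γ → ℝ) (ν : β → ℝ)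
    (hμ0 : ∀ t, 0 ≤ μ t) (hν0 : ∀ t, 0 ≤ ν t)
    (a : Fin 3 → γ → ℝ) (b : Fin 3 → β → ℝ) (ha0 : ∀ i t, 0 ≤ a i t) (hb0 : ∀ i t, 0 ≤ b i t)
    (hκ01 : ex μ (a 0) * ex μ (a 1) ≤ ex μ (a 0 * a 1)) (hκ02 : ex μ (a 0) * ex μ (a 2) ≤ ex μ (a 0 * a 2))
    (hκ12 : ex μ (a 1) * ex μ (a 2) ≤ ex μ (a 1 * a 2)) (hea : 0 ≤ sahiE μ 3 a)
    (hσ0 : ex ν (b 1 * b 2) * ex ν (b 0) ≤ ex ν (b 0 * b 1 * b 2)) (hσ1 : ex ν (b 0 * b 2) * ex ν (b 1) ≤ ex ν (b 0 * b 1 * b 2))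
    (hσ2 : ex ν (b 0 * b 1) * ex ν (b 2) ≤ ex ν (b 0 * b 1 * b 2)) (heb : 0 ≤ sahiE ν 3 b) :
    0 ≤ sahiE (fun p : γ × β => μ p.1 * ν p.2) 3 (fun (i : Fin 3) (p : γ × β) => a i p.1 * b i p.2) := by
  have m0 : ex (fun p : γ × β => μ p.1 * ν p.2) ((fun (i : Fin 3) (p : γ × β) => a i p.1 * b i p.2) 0) = ex μ (a 0) * ex ν (b 0) :=
    ex_tensor μ ν (a 0) (b 0) _ fun p => rfl
  have m1 : ex (fun p : γ × β => μ p.1 * ν p.2) ((fun (i : Fin 3) (p : γ × β) => a i p.1 * b i p.2) 1) = ex μ (a 1) * ex ν (b 1) :=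
    ex_tensor μ ν (a 1) (b 1) _ fun p => rfl
  have m2 : ex (fun p : γ × β => μ p.1 * ν p.2) ((fun (i : Fin 3) (p : γ × β) => a i p.1 * b i p.2) 2) = ex μ (a 2) * ex ν (b 2) :=
    ex_tensor μ ν (a 2) (b 2) _ fun p => rfl
  have m01 : ex (fun p : γ × β => μ p.1 * ν p.2)
      ((fun (i : Fin 3) (p : γ × β) => a i p.1 * b i p.2) 0 * (fun (i : Fin 3) (p : γ × β) => a i p.1 * b i p.2) 1)
      = ex μ (a 0 * a 1) * ex ν (b 0 * b 1) :=
    ex_tensor μ ν (a 0 * a 1) (b 0 * b 1) _ fun p => by simp only [Pi.mul_apply]; ring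
  have m02 : ex (fun p : γ × β => μ p.1 * ν p.2)
      ((fun (i : Fin 3) (p : γ × β) => a i p.1 * b i p.2) 0 * (fun (i : Fin 3) (p : γ × β) => a i p.1 * b i p.2) 2)
      = ex μ (a 0 * a 2) * ex ν (b 0 * b 2) :=
    ex_tensor μ ν (a 0 * a 2) (b 0 * b 2) _ fun p => by simp only [Pi.mul_apply]; ring
  have m12 : ex (fun p : γ × β => μ p.1 * ν p.2)
      ((fun (i : Fin 3) (p : γ × β) => a i p.1 * b i p.2) 1 * (fun (i : Fin 3) (p : γ × β) => a i p.1 * b i p.2) 2)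
      = ex μ (a 1 * a 2) * ex ν (b 1 * b 2) :=
    ex_tensor μ ν (a 1 * a 2) (b 1 * b 2) _ fun p => by simp only [Pi.mul_apply]; ring
  have m012 : ex (fun p : γ × β => μ p.1 * ν p.2)
      ((fun (i : Fin 3) (p : γ × β) => a i p.1 * b i p.2) 0 * (fun (i : Fin 3) (p : γ × β) => a i p.1 * b i p.2) 1
        * (fun (i : Fin 3) (p : γ × β) => a i p.1 * b i p.2) 2)
      = ex μ (a 0 * a 1 * a 2) * ex ν (b 0 * b 1 * b 2) :=
    ex_tensor μ ν (a 0 * a 1 * a 2) (b 0 * b 1 * b 2) _ fun p => by simp only [Pi.mul_apply]; ring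
  have hea' := hea
  have heb' := heb
  rw [sahiE_three_apply] at hea' heb'
  rw [sahiE_three_apply, m012, m0, m1, m2, m12, m02, m01]
  exact e3Tensor_nonneg_of_holdMoments _ _ _ _ _ _ _ _ _ _ _ _ _ _ (ex_nonneg hμ0 (ha0 0)) (ex_nonneg hμ0 (ha0 1)) (ex_nonneg hμ0 (ha0 2))
    hκ01 hκ02 hκ12 hea' (ex_nonneg hν0 fun t => mul_nonneg (mul_nonneg (hb0 0 t) (hb0 1 t)) (hb0 2 t)) hσ0 hσ1 hσ2 heb'

/-- **Lattice level, AND**: positively associated weights, nonnegative monotone `a_i`, `b_i` with `E₃(a) ≥ 0`, `E₃(b) ≥ 0` ⇒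
`E₃^{μ⊗ν}(a_ib_i) ≥ 0`. [this work] -/
theorem sahiE_three_pand_nonneg_of_sahiPositive_two {γ β : Type*} [Fintype γ] [Fintype β] [Preorder γ] [Preorder β] (μ : γ → ℝ) (ν : β → ℝ)
    (hμ0 : ∀ t, 0 ≤ μ t) (hν0 : ∀ t, 0 ≤ ν t) (hμ2 : SahiPositive μ 2) (hν2 : SahiPositive ν 2)
    (a : Fin 3 → γ → ℝ) (b : Fin 3 → β → ℝ) (ha0 : ∀ i t, 0 ≤ a i t) (ham : ∀ i, Monotone (a i))
    (hb0 : ∀ i t, 0 ≤ b i t) (hbm : ∀ i, Monotone (b i)) (hea : 0 ≤ sahiE μ 3 a) (heb : 0 ≤ sahiE ν 3 b) :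
    0 ≤ sahiE (fun p : γ × β => μ p.1 * ν p.2) 3 (fun (i : Fin 3) (p : γ × β) => a i p.1 * b i p.2) := by
  have hbb : ∀ i j, Monotone (b i * b j) := fun i j => (hbm i).mul (hbm j) (hb0 i) (hb0 j)
  have hbb0 : ∀ i j t, 0 ≤ (b i * b j) t := fun i j t => mul_nonneg (hb0 i t) (hb0 j t)
  have rb : ∀ i j k, ex ν (b i * b j) * ex ν (b k) ≤ ex ν (b i * b j * b k) := fun i j k =>
    ex_mul_le_of_sahiPositive_two ν hν2 _ _ (hbb0 i j) (hb0 k) (hbb i j) (hbm k)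
  have e120 : ∀ (f : Fin 3 → β → ℝ), f 1 * f 2 * f 0 = f 0 * f 1 * f 2 := fun f => by ring
  have e021 : ∀ (f : Fin 3 → β → ℝ), f 0 * f 2 * f 1 = f 0 * f 1 * f 2 := fun f => by ring
  exact sahiE_three_pand_nonneg μ ν hμ0 hν0 a b ha0 hb0
    (ex_mul_le_of_sahiPositive_two μ hμ2 _ _ (ha0 0) (ha0 1) (ham 0) (ham 1))
    (ex_mul_le_of_sahiPositive_two μ hμ2 _ _ (ha0 0) (ha0 2) (ham 0) (ham 2))
    (ex_mul_le_of_sahiPositive_two μ hμ2 _ _ (ha0 1) (ha0 2) (ham 1) (ham 2)) hea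
    (by simpa only [e120] using rb 1 2 0) (by simpa only [e021] using rb 0 2 1) (rb 0 1 2) heb

end AndStep

/-! ### Iterating at the lattice level: the product of two FKG weights is FKG on the product lattice -/

section ProdFKG

variable {γ β : Type*} [Fintype γ] [Fintype β] [Lattice γ] [Lattice β]

/-- **Product weights of FKG weights are FKG** on the product lattice (coordinatewise `⊓`, `⊔`): so after one OR- or AND-step the accumulated
space `γ × β` is again positively associated (`sahiPositive_two`), and `sahiE_three_por_nonneg_of_sahiPositive_two` /
`sahiE_three_pand_nonneg_of_sahiPositive_two` can be applied to the next independent block: the steps ITERATE over any number of FKG blocks each of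
which satisfies `C₃` (e.g. `2^X`, `|X| ≤ 3`, any FKG weight). [folklore] -/
theorem isFKGMeasure_prod {μ : γ → ℝ} {ν : β → ℝ} (hμ : IsFKGMeasure μ) (hν : IsFKGMeasure ν) :
    IsFKGMeasure (fun p : γ × β => μ p.1 * ν p.2) where
  nonneg p := mul_nonneg (hμ.nonneg p.1) (hν.nonneg p.2)
  sum_eq_one := sum_prodWeight μ ν hμ.sum_eq_one hν.sum_eq_one
  mul_le_mul p q := by
    have h1 := hμ.mul_le_mul p.1 q.1
    have h2 := hν.mul_le_mul p.2 q.2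
    have e : μ p.1 * ν p.2 * (μ q.1 * ν q.2) = (μ p.1 * μ q.1) * (ν p.2 * ν q.2) := by ring
    rw [Prod.fst_inf, Prod.snd_inf, Prod.fst_sup, Prod.snd_sup, e,
      show μ (p.1 ⊓ q.1) * ν (p.2 ⊓ q.2) * (μ (p.1 ⊔ q.1) * ν (p.2 ⊔ q.2))
        = (μ (p.1 ⊓ q.1) * μ (p.1 ⊔ q.1)) * (ν (p.2 ⊓ q.2) * ν (p.2 ⊔ q.2)) from by ring]
    exact mul_le_mul h1 h2 (mul_nonneg (hν.nonneg _) (hν.nonneg _)) (mul_nonneg (hμ.nonneg _) (hμ.nonneg _))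

end ProdFKG

end Summit.CriticalPhenomena.PercolationContinuityZ3.Theorems.SahiE3UnionTensor

end
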